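import Literature.Probability.RandomPlanarGeometry.SAWAdsorptionBridgeRateLower
import HarnessLib

/-!
# The four adsorption limits coincide (Janse van Rensburg–Whittington 2013, Lemma 1; Hammersley–Torrie–Whittington 1982):
# positive walks, loops, unfolded walks, unfolded loops

Topic `Literature/Probability/RandomPlanarGeometry` (continues `SAWAdsorptionBridgeRateLower.lean`: `Z⁺_n(a)^{1/n} → β(a)` and
`B_n(a)^{1/n} → β(a)` for `a ≥ 1`, `β(a)` the growth rate of the wall-returning `x`-bridges; `SAWAdsorptionArchUnfolding.lean`:
arches `Zd.arches n`, `Zd.archZ`).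

Janse van Rensburg–Whittington 2013 (J. Phys. A 46 435003, arXiv:1307.6457), Lemma 1 (arXiv p. 3; «See [HTW1982] for the proof
of this lemma»): «For unfolding in the x-direction and `a > 0` the following limits exist and are equal:
`lim n⁻¹ log C_n(a) = lim n⁻¹ log L_n(a) = lim n⁻¹ log C‡_n(a) = lim n⁻¹ log L‡_n(a) ≡ κ(a)`», where (same page) `C_n(a)` is the
partition function of `n`-step positive walks (the tree's `Zd.adsZ n a`), `L_n(a)` that of LOOPS (positive walks ending in the
surface: the tree's arches, `Zd.archZ n a`), `C‡_n(a)` that of positive walks UNFOLDED in the `x`-direction («`0 ≤ x_i < x_n`»;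
here `Zd.unfZ n a`, with the tree's convention `0 ≤ x₁(i)` for all `i ≤ n` and `x₁(i) < x₁(n)` for `i < n`), and `L‡_n(a)` that of
unfolded loops (the tree's wall-returning `x`-bridges, `AdsIrr.Bw n a`).

* `Zd.Bw_le_archZ`, `Zd.archZ_le_adsZ`, `Zd.Bw_le_unfZ`, `Zd.unfZ_le_adsZ` — the sandwich `L‡ ≤ L ≤ C`, `L‡ ≤ C‡ ≤ C`;
* `Zd.tendsto_archZ_rpow`, `Zd.tendsto_unfZ_rpow` — `L_n(a)^{1/n} → β(a)` and `C‡_n(a)^{1/n} → β(a)` for `a ≥ 1`;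
* **`Zd.JansevanRensburgWhittington2013_lemma1`** — for `a ≥ 1` the four sequences `C_n(a)^{1/n}`, `L_n(a)^{1/n}`,
  `C‡_n(a)^{1/n}`, `L‡_n(a)^{1/n}` converge to the same limit `e^{κ(a)} = Zd.adsRate a`.

Scope: printed for every `a > 0` and every `d ≥ 2`; formalised for `d = 2` and `a ≥ 1` (for `a ≤ 1` the tree has
`C_n(a)^{1/n} → μ`, `Zd.tendsto_adsZ_rpow_of_le_one`; the loop limits below `a = 1` are not treated here).
Label: CONSOLIDATION. Pure standard axioms.
-/

noncomputable section

open Finset Filter Topology Literature.Probability.LatticeModels SimpleGraph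
open scoped BigOperators

namespace Literature.Probability.RandomPlanarGeometry.SAW

/-- Reindexing inequality: an injection into a finset carrying nonnegative weights. [folklore] -/
private theorem sum_comp_le_sum_of_injOn' {ι κ : Type*} [DecidableEq κ] {s : Finset ι} {t : Finset κ}
    (e : ι → κ) (he : Set.InjOn e s) (hst : ∀ x ∈ s, e x ∈ t) (g : κ → ℝ)
    (hg : ∀ y ∈ t, 0 ≤ g y) : ∑ x ∈ s, g (e x) ≤ ∑ y ∈ t, g y := by
  rw [← Finset.sum_image (f := g) he]
  exact Finset.sum_le_sum_of_subset_of_nonneg (Finset.image_subset_iff.2 hst) fun b hb _ => hg b hb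

namespace Zd

/-! ### Unfolded positive walks and the sandwich -/

open Classical in
/-- **Positive walks unfolded in the `x`-direction** («`0 ≤ x_i < x_n`»; tree convention: `0 ≤ x₁(i)` for `i ≤ n`, `x₁(i) < x₁(n)`
for `i < n`). [cite: JansevanRensburgWhittington2013, §2 (arXiv p. 3: «unfolded in the x-direction if 0 ≤ x_i < x_n»)] -/
def unfoldedWalks (n : ℕ) : Finset (ℕ → Site 2) :=
  (hpWalks n).filter fun ω => (∀ i ≤ n, 0 ≤ ω i 1) ∧ ∀ i < n, ω i 1 < ω n 1

/-- **`C‡_n(a)`**, the partition function of unfolded positive walks. [cite: JansevanRensburgWhittington2013, §2 (arXiv p. 3, eq. (2.2): C‡_n(a))] -/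
def unfZ (n : ℕ) (a : ℝ) : ℝ := ∑ ω ∈ unfoldedWalks n, a ^ wallVisits n ω

/-- `L_n(a) ≤ C_n(a)`: loops are positive walks. [cite: JansevanRensburgWhittington2013, Lemma 1 (arXiv p. 3)] -/
theorem archZ_le_adsZ (n : ℕ) {a : ℝ} (ha : 0 ≤ a) : archZ n a ≤ adsZ n a := by
  classical
  unfold archZ adsZ arches
  exact Finset.sum_le_sum_of_subset_of_nonneg (Finset.filter_subset _ _) fun _ _ _ => pow_nonneg ha _

/-- `C‡_n(a) ≤ C_n(a)`: unfolded walks are positive walks. [cite: JansevanRensburgWhittington2013, Lemma 1 (arXiv p. 3)] -/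
theorem unfZ_le_adsZ (n : ℕ) {a : ℝ} (ha : 0 ≤ a) : unfZ n a ≤ adsZ n a := by
  classical
  unfold unfZ adsZ unfoldedWalks
  exact Finset.sum_le_sum_of_subset_of_nonneg (Finset.filter_subset _ _) fun _ _ _ => pow_nonneg ha _

/-- The trajectory of a wall-returning `x`-bridge word is an arch and an unfolded walk, with the same visits.
[cite: JansevanRensburgWhittington2013, §2 (arXiv p. 3: unfolded loops)] -/
theorem traj_mem_arches_of_isWXB {n : ℕ} {w : List Step} (hl : w.length = n) (hw : AdsIrr.IsWXB w) :
    traj w ∈ arches n ∧ traj w ∈ unfoldedWalks n := by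
  classical
  have hhp := AdsIrr.traj_mem_hpWalks hl hw
  obtain ⟨-, -, hend, hx0, hx⟩ := hw
  have hE : traj w n = wEnd w := by rw [← hl, traj_length]
  refine ⟨mem_arches.2 ⟨hhp, by rw [hE, hend]⟩, Finset.mem_filter.2 ⟨hhp, fun i hi => hx0 i (hl ▸ hi), fun i hi => ?_⟩⟩
  rw [hE]; exact hx i (hl ▸ hi)

/-- **`L‡_n(a) ≤ L_n(a)`**: unfolded loops are loops (`traj` is injective on words).
[cite: JansevanRensburgWhittington2013, Lemma 1 (arXiv p. 3)] -/
theorem Bw_le_archZ (n : ℕ) {a : ℝ} (ha : 0 ≤ a) : AdsIrr.Bw n a ≤ archZ n a := by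
  classical
  unfold AdsIrr.Bw archZ
  have heq : ∀ w ∈ AdsIrr.wxbWords n, a ^ AdsIrr.visits w = a ^ wallVisits n (traj w) := by
    intro w hw
    obtain ⟨hl, -⟩ := AdsIrr.mem_wxbWords.1 hw
    rw [AdsIrr.visits_eq_wallVisits, hl]
  rw [Finset.sum_congr rfl heq]
  refine sum_comp_le_sum_of_injOn' traj (fun w hw w' hw' h => traj_injOn n ?_ ?_ h) (fun w hw => ?_)
    (fun ω => a ^ wallVisits n ω) (fun _ _ => pow_nonneg ha _)
  · exact Finset.mem_coe.2 (mem_words.2 (AdsIrr.mem_wxbWords.1 (Finset.mem_coe.1 hw)).1)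
  · exact Finset.mem_coe.2 (mem_words.2 (AdsIrr.mem_wxbWords.1 (Finset.mem_coe.1 hw')).1)
  · obtain ⟨hl, hW⟩ := AdsIrr.mem_wxbWords.1 hw
    exact (traj_mem_arches_of_isWXB hl hW).1

/-- **`L‡_n(a) ≤ C‡_n(a)`**: unfolded loops are unfolded walks. [cite: JansevanRensburgWhittington2013, Lemma 1 (arXiv p. 3)] -/
theorem Bw_le_unfZ (n : ℕ) {a : ℝ} (ha : 0 ≤ a) : AdsIrr.Bw n a ≤ unfZ n a := by
  classical
  unfold AdsIrr.Bw unfZ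
  have heq : ∀ w ∈ AdsIrr.wxbWords n, a ^ AdsIrr.visits w = a ^ wallVisits n (traj w) := by
    intro w hw
    obtain ⟨hl, -⟩ := AdsIrr.mem_wxbWords.1 hw
    rw [AdsIrr.visits_eq_wallVisits, hl]
  rw [Finset.sum_congr rfl heq]
  refine sum_comp_le_sum_of_injOn' traj (fun w hw w' hw' h => traj_injOn n ?_ ?_ h) (fun w hw => ?_)
    (fun ω => a ^ wallVisits n ω) (fun _ _ => pow_nonneg ha _)
  · exact Finset.mem_coe.2 (mem_words.2 (AdsIrr.mem_wxbWords.1 (Finset.mem_coe.1 hw)).1)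
  · exact Finset.mem_coe.2 (mem_words.2 (AdsIrr.mem_wxbWords.1 (Finset.mem_coe.1 hw')).1)
  · obtain ⟨hl, hW⟩ := AdsIrr.mem_wxbWords.1 hw
    exact (traj_mem_arches_of_isWXB hl hW).2

/-! ### The four limits -/

/-- **`L_n(a)^{1/n} → β(a)`** for `a ≥ 1` (squeezed between `L‡` and `C`). [cite: JansevanRensburgWhittington2013, Lemma 1 (arXiv p. 3: «lim n⁻¹ log L_n(a) = κ(a)»)] -/
theorem tendsto_archZ_rpow {a β : ℝ} (ha : 1 ≤ a) (hβ0 : 0 < β)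
    (hβlim : Tendsto (fun n : ℕ => (AdsIrr.Bw n a) ^ (1 / (n : ℝ))) atTop (𝓝 β))
    (hβ : ∀ m, AdsIrr.Bw m a ≤ β ^ m) :
    Tendsto (fun n : ℕ => (archZ n a) ^ (1 / (n : ℝ))) atTop (𝓝 β) := by
  have h0 : 0 ≤ a := zero_le_one.trans ha
  refine tendsto_of_tendsto_of_tendsto_of_le_of_le hβlim (tendsto_adsZ_rpow_bridgeRate ha hβ0 hβlim hβ)
    (fun n => ?_) (fun n => ?_)
  · exact Real.rpow_le_rpow (AdsIrr.Bw_nonneg n h0) (Bw_le_archZ n h0) (by positivity)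
  · exact Real.rpow_le_rpow (archZ_nonneg n h0) (archZ_le_adsZ n h0) (by positivity)

/-- `C‡_n(a) ≥ 0`. [cite: JansevanRensburgWhittington2013, §2 (arXiv p. 3)] -/
theorem unfZ_nonneg (n : ℕ) {a : ℝ} (ha : 0 ≤ a) : 0 ≤ unfZ n a :=
  Finset.sum_nonneg fun _ _ => pow_nonneg ha _

/-- **`C‡_n(a)^{1/n} → β(a)`** for `a ≥ 1` (squeezed between `L‡` and `C`). [cite: JansevanRensburgWhittington2013, Lemma 1 (arXiv p. 3: «lim n⁻¹ log C‡_n(a) = κ(a)»)] -/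
theorem tendsto_unfZ_rpow {a β : ℝ} (ha : 1 ≤ a) (hβ0 : 0 < β)
    (hβlim : Tendsto (fun n : ℕ => (AdsIrr.Bw n a) ^ (1 / (n : ℝ))) atTop (𝓝 β))
    (hβ : ∀ m, AdsIrr.Bw m a ≤ β ^ m) :
    Tendsto (fun n : ℕ => (unfZ n a) ^ (1 / (n : ℝ))) atTop (𝓝 β) := by
  have h0 : 0 ≤ a := zero_le_one.trans ha
  refine tendsto_of_tendsto_of_tendsto_of_le_of_le hβlim (tendsto_adsZ_rpow_bridgeRate ha hβ0 hβlim hβ)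
    (fun n => ?_) (fun n => ?_)
  · exact Real.rpow_le_rpow (AdsIrr.Bw_nonneg n h0) (Bw_le_unfZ n h0) (by positivity)
  · exact Real.rpow_le_rpow (unfZ_nonneg n h0) (unfZ_le_adsZ n h0) (by positivity)

/-- **Janse van Rensburg–Whittington 2013, Lemma 1 (Hammersley–Torrie–Whittington 1982), for `d = 2` and `a ≥ 1`: the four
limits exist and are equal** — positive walks `C_n`, loops `L_n`, unfolded walks `C‡_n`, unfolded loops `L‡_n` all grow at the rate
`e^{κ(a)} = Zd.adsRate a`. [cite: JansevanRensburgWhittington2013, Lemma 1 (arXiv p. 3: «the following limits exist and are equal … ≡ κ(a)»; proof attributed to HammersleyTorrieWhittington1982)] -/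
theorem JansevanRensburgWhittington2013_lemma1 {a : ℝ} (ha : 1 ≤ a) :
    Tendsto (fun n : ℕ => (adsZ n a) ^ (1 / (n : ℝ))) atTop (𝓝 (adsRate a)) ∧
    Tendsto (fun n : ℕ => (archZ n a) ^ (1 / (n : ℝ))) atTop (𝓝 (adsRate a)) ∧
    Tendsto (fun n : ℕ => (unfZ n a) ^ (1 / (n : ℝ))) atTop (𝓝 (adsRate a)) ∧
    Tendsto (fun n : ℕ => (AdsIrr.Bw n a) ^ (1 / (n : ℝ))) atTop (𝓝 (adsRate a)) := by
  obtain ⟨β, hβ0, hβlim, hβ⟩ := AdsIrr.exists_tendsto_Bw_rpow (zero_lt_one.trans_le ha)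
  have hK : adsRate a = β := adsRate_eq_bridgeRate ha hβ0 hβlim hβ
  rw [hK]
  exact ⟨tendsto_adsZ_rpow_bridgeRate ha hβ0 hβlim hβ, tendsto_archZ_rpow ha hβ0 hβlim hβ,
    tendsto_unfZ_rpow ha hβ0 hβlim hβ, hβlim⟩

end Zd

end Literature.Probability.RandomPlanarGeometry.SAW
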